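import Summits.BirchSwinnertonDyer.BirchSwinnertonDyer.Theorems.AlignedTransportAtTwoMainConjectureOfRankZeroBSDAtTwoHalfDescentLayerIndexGrowthFiniteTwistProduct
import Summits.BirchSwinnertonDyer.BirchSwinnertonDyer.Theorems.AlignedTransportAtTwoMainConjectureOfRankZeroBSDAtTwoHalfDescentLayerIndexGrowthFiniteTwistRelaxed
import HarnessLib

/-!
# Route `AlignedTransportAtTwo`, crux C2 `MainConjectureOfRankZeroBSDAtTwo` (stmt-BirchSwinnertonDyer-22298):
# THE DOOR ON THE HONEST TWISTED SELMER GROUP — `#ker(N_{K_{n+1}/K_n} | Sel_{2^∞}(E/K_{n+1})) ∣ #Sel_{2^∞}(E′/K_n) · #ker g_n(E′)`, hence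
# `0 < #Sel_{2^∞}(E′/K_n) · #ker g_n(E′) · #ker g_{n+1}(E) < 2^{2ⁿ} ⟹ μ(X(E/K_∞)) = 0` and, on the seed cell, `2^{2ⁿμ} ∣ #Sel_{2^∞}(E′/K_n) · #ker g_n(E′) · #ker g_{n+1}(E)`;
# over `ℚ`: `2^{μ₂(X(E/ℚ_∞))} ∣ #Sel_{2^∞}(E^{(2)}/ℚ) · #ker g_0(E^{(2)}/ℚ) · #ker g_1(E/ℚ(√2))` — the seed's `μ₂` bounded by HONEST descent data of the twist and two control kernels

HONEST FRAMING (cell `bsd-f1-sign2`, WIDTH-5 attached prover seat `bsd-line-att-p5` gen 59 on line `birth` of the lead `bsd-line-att-p2`;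
`--supports` stmt-BirchSwinnertonDyer-22298, closes nothing; BSD is NOT proved by any of this; the crux C2, its verdict «blocked-on
`Rank1Residual.GreenbergMuConjectureIrreducible`» and every registered stub (P / T / Kμ / LimDoor / MuIneqʳ / PFμ⁺) are untouched). THEOREMS ONLY — no `def`,
no instance, no named fact, no `sorry`. Sequel of `…GrowthFiniteTwistRelaxed` (this gen: `Sel_n ≤ Sel♯_n ≤ A_n`, `#Sel♯_n ∣ #Sel_n · #ker g_n`, any `p`) and of gen 58's
`…GrowthFiniteTwistPlusMinus` / `…Product` (`#M_{n+1}(W) = #Sel♯_n(W′)` under a twisting datum; the exact door; the growth number on the twist).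

THE POINT. Gen 58 read gen 57's signed object `M_{n+1}(W) = ker(N_{K_{n+1}/K_n} | Sel_{2^∞}(W/K_{n+1}))` as the `K_{n+1}`-RELAXED `2^∞`-Selmer group of the twist
`W′` over `K_n`, `#M_{n+1}(W) = #Sel♯_n(W′)`, and gave two doors: the exact one on `#Sel♯_n(W′)·#ker g_{n+1}(W)` and a sandwich on `#Sel(W′/K_n)·#M[2]·#ker g_{n+1}`
(defect = the `2`-torsion of the upper-level object). THIS file trades the relaxation for Greenberg's LOCAL control number of the twist at level `n`:
★★★ **`#M_{n+1}(W) ∣ #Sel_{2^∞}(W′/K_n) · #ker g_n(W′)`** (`natCard_normKer_dvd_natCard_selmerLayer_twist_mul_kerG`), so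
★★★ **`0 < #Sel_{2^∞}(W′/K_n) · #ker g_n(W′) · #ker g_{n+1}(W) < 2^{2ⁿ}` ⟹ `μ(X(W/K_∞)) = 0`** (any rank; `X` f.g. torsion; `W′[2^∞]^{Gal(K̄/K_{n+1})} = 0`) and on the seed cell
★★ **`2^{2ⁿ·μ} ∣ #Sel_{2^∞}(W′/K_n) · #ker g_n(W′) · #ker g_{n+1}(W)`**, **`g_n ∣ #Sel_{2^∞}(W′/K_n) · #ker g_n(W′) · #ker g_{n+1}(W)`** — every factor is an HONEST object: ONE
`2^∞`-Selmer group of ONE quadratic twist over the smaller field and two of Greenberg's control kernels (`ker g_m = A_m/Sel_m`, the tree's `KerG`, bounded in print by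
Tamagawa numbers and `#Ẽ(f_v)[2]²`, LNM 1716 Lemmas 3.3–3.5). Also the HONEST order form of Dokchitser–Dokchitser's Lemma 4.14:
★★ **`#Sel_{2^∞}(W/K_{n+1}) ∣ #Sel_{2^∞}(W/K_n)·#ker g_n(W) · #Sel_{2^∞}(W′/K_n)·#ker g_n(W′)`**. §2 discharges the datum at the first layer `K_1 = K(√d)` over ANY number
field (`W′ = W^{(d)}`, tree `twistH1Equiv`), §3 over `ℚ` with `κ` cyclotomic (`ℚ_1 = ℚ(√2)`): ★★ **`2^{μ₂(X(E/ℚ_∞))} ∣ #Sel_{2^∞}(E^{(2)}/ℚ) · #ker g_0(E^{(2)}/ℚ) · #ker g_1(E/ℚ(√2))`**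
for every elliptic `E/ℚ` without a rational `2`-torsion abscissa and every Pontryagin-dual datum with `X` f.g. torsion.
HONEST CAVEATS. All statements are `Nat.card` divisibilities/inequalities: where a kernel is infinite its `Nat.card` is `0` and a divisibility `∣ … · 0` is EMPTY — in particular
`#ker g_0(E^{(2)}/ℚ)` is Greenberg's level-`0` kernel of the twist, whose prime `2` is ADDITIVE for `E^{(2)}`; its finiteness is Greenberg's Lemma 3.3/Prop. 4.x territory and is
NOT decided here (the door hypotheses `0 < …` make finiteness explicit where it matters). Compared with gen 58's exact door this one is WEAKER (`#Sel♯ ≤ #Sel·#ker g_n`) but reads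
on honest objects only; completeness (`μ = 0 ⟹ ∃ n, door`) is NOT claimed for this form. Nothing numerical about any curve; no Selmer group or kernel computed; C2 untouched.
Memo `Cruxes/MainConjectureOfRankZeroBSDAtTwo/RELAXED-PREIMAGE-att-p5-g59.md`.

References: R. Greenberg, LNM 1716 (1999), §1 Conj. 1.11, §3 pp. 85–90 (Lemmas 3.1–3.5, `g_n`), §4 Lemma 4.3, p. 107 [GreenbergLNM1716]; T. Dokchitser, V. Dokchitser, Ann. of Math.
172 (2010), Lemma 4.14 (proof) [DokchitserDokchitserAnnals2010]; K. Kramer, Trans. AMS 264 (1981), Prop. 7, eq. (11), Thm. 1 [Kramer1981]; B. Mazur, Invent. Math. 18 (1972) §6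
[Mazur1972]; J.-P. Serre, *Galois Cohomology*, I.§2.6 [SerreGaloisCohomology1997]; J. Silverman, AEC, X.2 Prop. 2.4 [SilvermanAEC2009]; L. Washington, GTM 83, §13.1, §13.3
Thm. 13.13 [Washington1997].
-/

set_option linter.dupNamespace false
set_option autoImplicit false

noncomputable section

open scoped Classical AddSubgroup Polynomial

universe u

namespace Summit.BirchSwinnertonDyer.BirchSwinnertonDyer.Theorems.AlignedTransportAtTwoHalfDescentLayerIndexGrowthFiniteTwistHonest

open WeierstrassCurve Literature.NumberTheory.EllipticCurves Literature.NumberTheory.EllipticCurves.IwasawaDual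
  Literature.NumberTheory.EllipticCurves.IwasawaAlgebra
  Literature.NumberTheory.EllipticCurves.Greenberg1999
  Summit.BirchSwinnertonDyer.Rank1Residual.X1.MuLambda
  Summit.BirchSwinnertonDyer.Rank1Residual.Iwasawa
  Summit.BirchSwinnertonDyer.BirchSwinnertonDyer.Theorems
  Summit.BirchSwinnertonDyer.BirchSwinnertonDyer.Theorems.AlignedTransportAtTwoHalfDescentLayerIndexGrowthFinite
  Summit.BirchSwinnertonDyer.BirchSwinnertonDyer.Theorems.AlignedTransportAtTwoHalfDescentLayerIndexGrowthFiniteTwo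
  Summit.BirchSwinnertonDyer.BirchSwinnertonDyer.Theorems.AlignedTransportAtTwoHalfDescentLayerIndexGrowthFiniteCell
  Summit.BirchSwinnertonDyer.BirchSwinnertonDyer.Theorems.AlignedTransportAtTwoHalfDescentLayerIndexGrowthFiniteTwist
  Summit.BirchSwinnertonDyer.BirchSwinnertonDyer.Theorems.AlignedTransportAtTwoHalfDescentLayerIndexGrowthFiniteTwistMinus
  Summit.BirchSwinnertonDyer.BirchSwinnertonDyer.Theorems.AlignedTransportAtTwoHalfDescentLayerIndexGrowthFiniteTwistQuadratic
  Summit.BirchSwinnertonDyer.BirchSwinnertonDyer.Theorems.AlignedTransportAtTwoHalfDescentLayerIndexGrowthFiniteTwistPlusMinus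
  Summit.BirchSwinnertonDyer.BirchSwinnertonDyer.Theorems.AlignedTransportAtTwoHalfDescentLayerIndexGrowthFiniteTwistProduct
  Summit.BirchSwinnertonDyer.BirchSwinnertonDyer.Theorems.AlignedTransportAtTwoHalfDescentLayerIndexGrowthFiniteTwistRelaxed

/-! ## §1 Abstract twisting datum, any layer: the relaxation traded for Greenberg's kernel of the twist -/

section Datum

variable {K : Type u} [Field K] [NumberField K] (W W' : WeierstrassCurve K) (κ : ZpExtension K 2) {γ : Field.absoluteGaloisGroup K} (n : ℕ)
  (Ψ : W'.subgroupH1 2 (κ.layerSubgroup (n + 1)) ≃+ W.subgroupH1 2 (κ.layerSubgroup (n + 1)))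

/-- ★★★ **`#M_{n+1}(W) = #ker(N_{K_{n+1}/K_n} | Sel_{2^∞}(W/K_{n+1})) ∣ #Sel_{2^∞}(W′/K_n) · #ker g_n(W′)`** under a twisting datum `Ψ` (`Ψ(Sel′) = Sel`, `Ψ ∘ conj′_g = −conj_g ∘ Ψ`) with
`W′[2^∞]^{Gal(K̄/K_{n+1})} = 0`: gen 58's exact identity `#M_{n+1}(W) = #Sel♯_n(W′)` followed by this gen's `#Sel♯_n ∣ #Sel_n · #ker g_n` for the twist. The signed object at `2` at finite
level is controlled by the HONEST `2^∞`-Selmer group of the twist one layer down and Greenberg's control kernel of the twist at that layer.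
[cite: DokchitserDokchitserAnnals2010, Lemma 4.14 (proof)] [cite: GreenbergLNM1716, §3 pp. 85–90, §4 p. 107] -/
theorem natCard_normKer_dvd_natCard_selmerLayer_twist_mul_kerG (hγ : κ.IsTopGenerator γ) (hΨsel : ∀ x, x ∈ W'.selmerLayer κ (n + 1) ↔ Ψ x ∈ W.selmerLayer κ (n + 1))
    (hΨg : ∀ x, Ψ (W'.conjH1 2 (κ.layerSubgroup (n + 1)) (γ ^ 2 ^ n) x) = -(W.conjH1 2 (κ.layerSubgroup (n + 1)) (γ ^ 2 ^ n) (Ψ x)))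
    (hfix' : FixedPoints.addSubgroup (κ.layerSubgroup (n + 1)) (W'.geomPrimaryTorsion 2) = ⊥) :
    Nat.card ↥(W.selmerLayer κ (n + 1) ⊓ (W.conjH1 2 (κ.layerSubgroup (n + 1)) (γ ^ 2 ^ n) + AddMonoidHom.id (W.subgroupH1 2 (κ.layerSubgroup (n + 1)))).ker) ∣
      Nat.card (W'.selmerLayer κ n) * Nat.card (W'.KerG κ n) := by
  rw [natCard_normKer_eq_natCard_twist_comap W W' κ n Ψ hγ hΨsel hΨg hfix']
  exact (natCard_comap_resOfLe_selmerLayer_dvd W' κ (Nat.le_succ n)).2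

/-- ★★ Exact form: **`#M_{n+1}(W) = #Sel_{2^∞}(W′/K_n) · [Sel♯_n(W′) : Sel_{2^∞}(W′/K_n)]`** with the index dividing `#ker g_n(W′)` (same hypotheses).
[cite: DokchitserDokchitserAnnals2010, Lemma 4.14 (proof)] [cite: GreenbergLNM1716, §3 pp. 85–90] -/
theorem natCard_normKer_eq_natCard_selmerLayer_twist_mul_relIndex (hγ : κ.IsTopGenerator γ) (hΨsel : ∀ x, x ∈ W'.selmerLayer κ (n + 1) ↔ Ψ x ∈ W.selmerLayer κ (n + 1))
    (hΨg : ∀ x, Ψ (W'.conjH1 2 (κ.layerSubgroup (n + 1)) (γ ^ 2 ^ n) x) = -(W.conjH1 2 (κ.layerSubgroup (n + 1)) (γ ^ 2 ^ n) (Ψ x)))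
    (hfix' : FixedPoints.addSubgroup (κ.layerSubgroup (n + 1)) (W'.geomPrimaryTorsion 2) = ⊥) :
    Nat.card ↥(W.selmerLayer κ (n + 1) ⊓ (W.conjH1 2 (κ.layerSubgroup (n + 1)) (γ ^ 2 ^ n) + AddMonoidHom.id (W.subgroupH1 2 (κ.layerSubgroup (n + 1)))).ker) =
        Nat.card (W'.selmerLayer κ n) *
          (W'.selmerLayer κ n).relIndex ((W'.selmerLayer κ (n + 1)).comap (W'.resOfLe 2 (κ.layerSubgroup_antitone (Nat.le_succ n)))) ∧
      (W'.selmerLayer κ n).relIndex ((W'.selmerLayer κ (n + 1)).comap (W'.resOfLe 2 (κ.layerSubgroup_antitone (Nat.le_succ n)))) ∣ Nat.card (W'.KerG κ n) := by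
  rw [natCard_normKer_eq_natCard_twist_comap W W' κ n Ψ hγ hΨsel hΨg hfix']
  exact ⟨natCard_comap_resOfLe_selmerLayer_eq_mul W' κ (Nat.le_succ n), relIndex_selmerLayer_comap_dvd_natCard_kerG W' κ (Nat.le_succ n)⟩

/-- ★★ THE HONEST ORDER FORM OF DOKCHITSER–DOKCHITSER'S LEMMA 4.14 (`W[2^∞]`, `W′[2^∞]` without non-zero `Gal(K̄/K_{n+1})`-fixed points; twisting datum `Ψ`):
**`#Sel_{2^∞}(W/K_{n+1}) ∣ (#Sel_{2^∞}(W/K_n) · #ker g_n(W)) · (#Sel_{2^∞}(W′/K_n) · #ker g_n(W′))`** — gen 58's `#Sel_{n+1} ∣ #Sel♯_n(W)·#Sel♯_n(W′)` with both relaxations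
traded for Greenberg's kernels. [cite: DokchitserDokchitserAnnals2010, Lemma 4.14 (proof)] [cite: GreenbergLNM1716, §3 pp. 85–90, §4 p. 107] [cite: Kramer1981, Thm. 1, Prop. 7] -/
theorem natCard_selmerLayer_succ_dvd_honest (hγ : κ.IsTopGenerator γ) (hΨsel : ∀ x, x ∈ W'.selmerLayer κ (n + 1) ↔ Ψ x ∈ W.selmerLayer κ (n + 1))
    (hΨg : ∀ x, Ψ (W'.conjH1 2 (κ.layerSubgroup (n + 1)) (γ ^ 2 ^ n) x) = -(W.conjH1 2 (κ.layerSubgroup (n + 1)) (γ ^ 2 ^ n) (Ψ x)))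
    (hfix : FixedPoints.addSubgroup (κ.layerSubgroup (n + 1)) (W.geomPrimaryTorsion 2) = ⊥)
    (hfix' : FixedPoints.addSubgroup (κ.layerSubgroup (n + 1)) (W'.geomPrimaryTorsion 2) = ⊥) :
    Nat.card (W.selmerLayer κ (n + 1)) ∣
      (Nat.card (W.selmerLayer κ n) * Nat.card (W.KerG κ n)) * (Nat.card (W'.selmerLayer κ n) * Nat.card (W'.KerG κ n)) :=
  (natCard_selmerLayer_succ_dvd_natCard_comap_mul_comap W W' κ n Ψ hγ hΨsel hΨg hfix hfix').trans
    (mul_dvd_mul (natCard_comap_resOfLe_selmerLayer_dvd W κ (Nat.le_succ n)).2 (natCard_comap_resOfLe_selmerLayer_dvd W' κ (Nat.le_succ n)).2)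

/-- ★★★ THE DOOR ON THE HONEST TWISTED SELMER GROUP (any rank; `X` finitely generated torsion; `W′[2^∞]^{Gal(K̄/K_{n+1})} = 0`; twisting datum `Ψ`):
**`0 < #Sel_{2^∞}(W′/K_n) · #ker g_n(W′) · #ker g_{n+1}(W) < 2^{2ⁿ}` at SOME layer ⟹ `μ(X(W/K_∞)) = 0`** — gen 58's exact door fed by `#Sel♯_n(W′) ∣ #Sel_n(W′)·#ker g_n(W′)`: the `μ`-input of the
seed is ONE inequality on ONE honest `2^∞`-Selmer group of ONE quadratic twist over `K_n` and two of Greenberg's explicit control kernels.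
[cite: GreenbergLNM1716, Conj. 1.11, §3 Lemmas 3.1–3.5, §4 Lemma 4.3] [cite: Mazur1972, §6] [cite: Washington1997, §13.3 Thm. 13.13] -/
theorem mu_eq_zero_of_natCard_selmerLayer_twist_mul_kerG_mul_kerG_lt (hγ : κ.IsTopGenerator γ) (hΨsel : ∀ x, x ∈ W'.selmerLayer κ (n + 1) ↔ Ψ x ∈ W.selmerLayer κ (n + 1))
    (hΨg : ∀ x, Ψ (W'.conjH1 2 (κ.layerSubgroup (n + 1)) (γ ^ 2 ^ n) x) = -(W.conjH1 2 (κ.layerSubgroup (n + 1)) (γ ^ 2 ^ n) (Ψ x)))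
    (hfix' : FixedPoints.addSubgroup (κ.layerSubgroup (n + 1)) (W'.geomPrimaryTorsion 2) = ⊥)
    (D : W.SelmerDualData κ γ) [Module.Finite (IwasawaAlgebra 2) D.X] (hD : D.IsTorsion)
    (hpos : 0 < Nat.card (W'.selmerLayer κ n) * Nat.card (W'.KerG κ n) * Nat.card (W.KerG κ (n + 1)))
    (hlt : Nat.card (W'.selmerLayer κ n) * Nat.card (W'.KerG κ n) * Nat.card (W.KerG κ (n + 1)) < 2 ^ 2 ^ n) : D.mu = 0 := by
  have hdvd : Nat.card ↥((W'.selmerLayer κ (n + 1)).comap (W'.resOfLe 2 (κ.layerSubgroup_antitone (Nat.le_succ n)))) * Nat.card (W.KerG κ (n + 1)) ∣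
      Nat.card (W'.selmerLayer κ n) * Nat.card (W'.KerG κ n) * Nat.card (W.KerG κ (n + 1)) :=
    mul_dvd_mul_right (natCard_comap_resOfLe_selmerLayer_dvd W' κ (Nat.le_succ n)).2 _
  exact mu_eq_zero_of_natCard_twist_comap_mul_kerG_lt W W' κ n Ψ hγ hΨsel hΨg hfix' D hD (Nat.pos_of_dvd_of_pos hdvd hpos)
    ((Nat.le_of_dvd hpos hdvd).trans_lt hlt)

/-- ★★ Seed cell for BOTH curves (`W(K)[2] = 0`, `W′[2^∞]^{Gal(K̄/K_{n+1})} = 0`; `X` f.g. torsion; any rank): **`2^{2ⁿ·μ(X(W/K_∞))} ∣ #Sel_{2^∞}(W′/K_n) · #ker g_n(W′) · #ker g_{n+1}(W)`** —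
the `μ`-invariant read on honest descent data of the twist one layer down plus two control kernels. [cite: GreenbergLNM1716, Conj. 1.11, §3 Lemmas 3.1–3.5, §4 Lemma 4.3]
[cite: Washington1997, §13.3 Thm. 13.13] -/
theorem pow_mu_dvd_natCard_selmerLayer_twist_mul_kerG_mul_kerG [W.IsElliptic] (hK : ∀ P : W.toAffine.Point, 2 • P = 0 → P = 0) (hγ : κ.IsTopGenerator γ)
    (hΨsel : ∀ x, x ∈ W'.selmerLayer κ (n + 1) ↔ Ψ x ∈ W.selmerLayer κ (n + 1))
    (hΨg : ∀ x, Ψ (W'.conjH1 2 (κ.layerSubgroup (n + 1)) (γ ^ 2 ^ n) x) = -(W.conjH1 2 (κ.layerSubgroup (n + 1)) (γ ^ 2 ^ n) (Ψ x)))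
    (hfix' : FixedPoints.addSubgroup (κ.layerSubgroup (n + 1)) (W'.geomPrimaryTorsion 2) = ⊥)
    (D : W.SelmerDualData κ γ) [Module.Finite (IwasawaAlgebra 2) D.X] (hD : D.IsTorsion) :
    2 ^ (2 ^ n * D.mu) ∣ Nat.card (W'.selmerLayer κ n) * Nat.card (W'.KerG κ n) * Nat.card (W.KerG κ (n + 1)) :=
  (pow_mu_dvd_natCard_twist_comap_mul_kerG W W' κ n Ψ hK hγ hΨsel hΨg hfix' D hD).trans
    (mul_dvd_mul_right (natCard_comap_resOfLe_selmerLayer_dvd W' κ (Nat.le_succ n)).2 _)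

/-- ★★ Seed cell, EVERY Pontryagin-dual datum (no torsion / finiteness assumed): **`g_n ∣ #Sel_{2^∞}(W′/K_n) · #ker g_n(W′) · #ker g_{n+1}(W)`** — the growth number `g_n = #(ω_nX/ω_{n+1}X)` of
`X(W/K_∞)` (gens 56–58) is bounded by the honest `2^∞`-descent of the twist one layer down and two control kernels. [cite: GreenbergLNM1716, §1 pp. 60–65, §3 pp. 85–90, §4 Lemma 4.3]
[cite: Mazur1972, §6] -/
theorem growth_dvd_natCard_selmerLayer_twist_mul_kerG_mul_kerG [W.IsElliptic] (hK : ∀ P : W.toAffine.Point, 2 • P = 0 → P = 0) (hγ : κ.IsTopGenerator γ)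
    (hΨsel : ∀ x, x ∈ W'.selmerLayer κ (n + 1) ↔ Ψ x ∈ W.selmerLayer κ (n + 1))
    (hΨg : ∀ x, Ψ (W'.conjH1 2 (κ.layerSubgroup (n + 1)) (γ ^ 2 ^ n) x) = -(W.conjH1 2 (κ.layerSubgroup (n + 1)) (γ ^ 2 ^ n) (Ψ x)))
    (hfix' : FixedPoints.addSubgroup (κ.layerSubgroup (n + 1)) (W'.geomPrimaryTorsion 2) = ⊥) (D : W.SelmerDualData κ γ) :
    Nat.card (↥(Ideal.span {((1 + PowerSeries.X : PowerSeries ℤ_[2]) ^ (2 ^ n) - 1 : IwasawaAlgebra 2)} • ⊤ : Submodule (IwasawaAlgebra 2) D.X) ⧸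
        (Ideal.span {(((Polynomial.cyclotomic (2 ^ (n + 1)) ℤ_[2]).comp (Polynomial.X + 1) : ℤ_[2][X]) : IwasawaAlgebra 2)} • ⊤ :
          Submodule (IwasawaAlgebra 2) ↥(Ideal.span {((1 + PowerSeries.X : PowerSeries ℤ_[2]) ^ (2 ^ n) - 1 : IwasawaAlgebra 2)} • ⊤ :
            Submodule (IwasawaAlgebra 2) D.X))) ∣
      Nat.card (W'.selmerLayer κ n) * Nat.card (W'.KerG κ n) * Nat.card (W.KerG κ (n + 1)) :=
  (growth_dvd_natCard_comap_mul_kerG_and_dvd W W' κ n Ψ hK hγ hΨsel hΨg hfix' D).1.trans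
    (mul_dvd_mul_right (natCard_comap_resOfLe_selmerLayer_dvd W' κ (Nat.le_succ n)).2 _)

end Datum

/-! ## §2 The first layer for the quadratic twist `W^{(d)}`, `K_1 = K(√d)` (any number field) -/

section Quadratic

variable {K : Type u} [Field K] [NumberField K] (W : WeierstrassCurve K) [W.IsElliptic] (κ : ZpExtension K 2) {γ : Field.absoluteGaloisGroup K}
  {d : K} {θ : AlgebraicClosure K}

/-- ★★★ **`#ker(N_{K_1/K} | Sel_{2^∞}(W/K_1)) ∣ #Sel_{2^∞}(W^{(d)}/K) · #ker g_0(W^{(d)})`** for EVERY number field `K`, `ℤ₂`-extension `κ` with topological generator `γ`, first layer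
`K_1 = K(√d)`, and `W` with `W(K)[2] = 0`: the signed object at the first layer is controlled by the HONEST `2^∞`-Selmer group of the quadratic twist over the BASE and Greenberg's
level-`0` control kernel of the twist. [cite: DokchitserDokchitserAnnals2010, Lemma 4.14 (proof)] [cite: GreenbergLNM1716, §3 pp. 85–90, §4 p. 107] [cite: SilvermanAEC2009, X.2 Prop. 2.4] -/
theorem natCard_normKer_dvd_quadraticTwist_selmer_mul_kerG (hK : ∀ P : W.toAffine.Point, 2 • P = 0 → P = 0) (hγ : κ.IsTopGenerator γ)
    (hd : d ≠ 0) (hθ : θ ^ 2 = algebraMap K (AlgebraicClosure K) d)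
    (hθ1 : ∀ σ : Field.absoluteGaloisGroup K, σ ∈ κ.layerSubgroup 1 → σ • θ = θ) (hγθ : γ • θ = -θ) :
    Nat.card ↥(W.selmerLayer κ 1 ⊓ (W.conjH1 2 (κ.layerSubgroup 1) γ + AddMonoidHom.id (W.subgroupH1 2 (κ.layerSubgroup 1))).ker) ∣
      Nat.card ((W.quadraticTwist d).selmerLayer κ 0) * Nat.card ((W.quadraticTwist d).KerG κ 0) := by
  rw [natCard_normKer_eq_natCard_quadraticTwist_comap W κ hK hγ hd hθ hθ1 hγθ]
  exact (natCard_comap_resOfLe_selmerLayer_dvd (W.quadraticTwist d) κ (Nat.le_succ 0)).2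

/-- ★★ **`#Sel_{2^∞}(W/K_1) ∣ (#Sel_{2^∞}(W/K)·#ker g_0(W)) · (#Sel_{2^∞}(W^{(d)}/K)·#ker g_0(W^{(d)}))`** (`K_1 = K(√d)`, `W(K)[2] = 0`): the honest order form of D–D Lemma 4.14 /
Kramer's Theorem 1 at the first layer of a `ℤ₂`-tower, with Greenberg-kernel defects. [cite: DokchitserDokchitserAnnals2010, Lemma 4.14 (proof)] [cite: Kramer1981, Thm. 1, Prop. 7]
[cite: GreenbergLNM1716, §3 pp. 85–90] -/
theorem natCard_selmerLayer_one_dvd_quadraticTwist_honest (hK : ∀ P : W.toAffine.Point, 2 • P = 0 → P = 0) (hγ : κ.IsTopGenerator γ)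
    (hd : d ≠ 0) (hθ : θ ^ 2 = algebraMap K (AlgebraicClosure K) d)
    (hθ1 : ∀ σ : Field.absoluteGaloisGroup K, σ ∈ κ.layerSubgroup 1 → σ • θ = θ) (hγθ : γ • θ = -θ) :
    Nat.card (W.selmerLayer κ 1) ∣
      (Nat.card (W.selmerLayer κ 0) * Nat.card (W.KerG κ 0)) * (Nat.card ((W.quadraticTwist d).selmerLayer κ 0) * Nat.card ((W.quadraticTwist d).KerG κ 0)) :=
  (natCard_selmerLayer_one_dvd_and_dvd_quadraticTwist W κ hK hγ hd hθ hθ1 hγθ).1.trans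
    (mul_dvd_mul (natCard_comap_resOfLe_selmerLayer_dvd W κ (Nat.le_succ 0)).2 (natCard_comap_resOfLe_selmerLayer_dvd (W.quadraticTwist d) κ (Nat.le_succ 0)).2)

/-- ★★★ THE HONEST DOOR AT THE FIRST LAYER (any `K`; `W(K)[2] = 0`; `X` f.g. torsion; any rank):
**`0 < #Sel_{2^∞}(W^{(d)}/K) · #ker g_0(W^{(d)}) · #ker g_1(W) < 2` (i.e. all three trivial) ⟹ `μ(X(W/K_∞)) = 0`**. [cite: GreenbergLNM1716, Conj. 1.11, §3 Lemmas 3.1–3.5, §4 Lemma 4.3]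
[cite: Washington1997, §13.3 Thm. 13.13] -/
theorem mu_eq_zero_of_quadraticTwist_selmer_mul_kerG_mul_kerG_lt (hK : ∀ P : W.toAffine.Point, 2 • P = 0 → P = 0) (hγ : κ.IsTopGenerator γ)
    (hd : d ≠ 0) (hθ : θ ^ 2 = algebraMap K (AlgebraicClosure K) d)
    (hθ1 : ∀ σ : Field.absoluteGaloisGroup K, σ ∈ κ.layerSubgroup 1 → σ • θ = θ) (hγθ : γ • θ = -θ)
    (D : W.SelmerDualData κ γ) [Module.Finite (IwasawaAlgebra 2) D.X] (hD : D.IsTorsion)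
    (hpos : 0 < Nat.card ((W.quadraticTwist d).selmerLayer κ 0) * Nat.card ((W.quadraticTwist d).KerG κ 0) * Nat.card (W.KerG κ 1))
    (hlt : Nat.card ((W.quadraticTwist d).selmerLayer κ 0) * Nat.card ((W.quadraticTwist d).KerG κ 0) * Nat.card (W.KerG κ 1) < 2) : D.mu = 0 := by
  obtain ⟨Ψ, hΨsel, hΨγ⟩ := AlignedTransportAtTwoHalfDescentLayerIndexGrowthFiniteTwistQuadratic.exists_twistDatum W κ hd hθ hθ1 hγθ
  have hΨg : ∀ x, Ψ ((W.quadraticTwist d).conjH1 2 (κ.layerSubgroup (0 + 1)) (γ ^ 2 ^ 0) x) =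
      -(W.conjH1 2 (κ.layerSubgroup (0 + 1)) (γ ^ 2 ^ 0) (Ψ x)) := by
    simpa only [pow_zero, pow_one] using hΨγ
  have hfix' : FixedPoints.addSubgroup (κ.layerSubgroup (0 + 1)) ((W.quadraticTwist d).geomPrimaryTorsion 2) = ⊥ :=
    fixedPoints_eq_bot_of_forall (W.quadraticTwist d) _ (AlignedTransportAtTwoHalfDescentLayerIndexGrowthFiniteTwistQuadratic.forall_fixed_quadraticTwist_eq_zero W κ hK hd hθ hθ1)
  have hpos' : 0 < Nat.card ((W.quadraticTwist d).selmerLayer κ 0) * Nat.card ((W.quadraticTwist d).KerG κ 0) * Nat.card (W.KerG κ (0 + 1)) := hpos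
  have hlt' : Nat.card ((W.quadraticTwist d).selmerLayer κ 0) * Nat.card ((W.quadraticTwist d).KerG κ 0) * Nat.card (W.KerG κ (0 + 1)) < 2 ^ 2 ^ 0 := by
    simpa only [pow_zero, pow_one] using hlt
  exact mu_eq_zero_of_natCard_selmerLayer_twist_mul_kerG_mul_kerG_lt W (W.quadraticTwist d) κ 0 Ψ hγ hΨsel hΨg hfix' D hD hpos' hlt'

/-- ★★ **`2^{μ(X(W/K_∞))} ∣ #Sel_{2^∞}(W^{(d)}/K) · #ker g_0(W^{(d)}) · #ker g_1(W)`** (`W(K)[2] = 0`, `K_1 = K(√d)`, `X` f.g. torsion, any rank): the `μ`-invariant of `W` over the `ℤ₂`-tower is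
bounded by the HONEST `2^∞`-descent of the quadratic twist over the base and two control kernels. [cite: GreenbergLNM1716, Conj. 1.11, §3 Lemmas 3.1–3.5, §4 Lemma 4.3] [cite: Washington1997, §13.3 Thm. 13.13] -/
theorem pow_mu_dvd_quadraticTwist_selmer_mul_kerG_mul_kerG (hK : ∀ P : W.toAffine.Point, 2 • P = 0 → P = 0) (hγ : κ.IsTopGenerator γ)
    (hd : d ≠ 0) (hθ : θ ^ 2 = algebraMap K (AlgebraicClosure K) d)
    (hθ1 : ∀ σ : Field.absoluteGaloisGroup K, σ ∈ κ.layerSubgroup 1 → σ • θ = θ) (hγθ : γ • θ = -θ)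
    (D : W.SelmerDualData κ γ) [Module.Finite (IwasawaAlgebra 2) D.X] (hD : D.IsTorsion) :
    2 ^ D.mu ∣ Nat.card ((W.quadraticTwist d).selmerLayer κ 0) * Nat.card ((W.quadraticTwist d).KerG κ 0) * Nat.card (W.KerG κ 1) := by
  obtain ⟨Ψ, hΨsel, hΨγ⟩ := AlignedTransportAtTwoHalfDescentLayerIndexGrowthFiniteTwistQuadratic.exists_twistDatum W κ hd hθ hθ1 hγθ
  have hΨg : ∀ x, Ψ ((W.quadraticTwist d).conjH1 2 (κ.layerSubgroup (0 + 1)) (γ ^ 2 ^ 0) x) =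
      -(W.conjH1 2 (κ.layerSubgroup (0 + 1)) (γ ^ 2 ^ 0) (Ψ x)) := by
    simpa only [pow_zero, pow_one] using hΨγ
  have hfix' : FixedPoints.addSubgroup (κ.layerSubgroup (0 + 1)) ((W.quadraticTwist d).geomPrimaryTorsion 2) = ⊥ :=
    fixedPoints_eq_bot_of_forall (W.quadraticTwist d) _ (AlignedTransportAtTwoHalfDescentLayerIndexGrowthFiniteTwistQuadratic.forall_fixed_quadraticTwist_eq_zero W κ hK hd hθ hθ1)
  have h := pow_mu_dvd_natCard_selmerLayer_twist_mul_kerG_mul_kerG W (W.quadraticTwist d) κ 0 Ψ hK hγ hΨsel hΨg hfix' D hD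
  simpa only [pow_zero, pow_one, one_mul] using h

end Quadratic

/-! ## §3 `K = ℚ`, `κ` cyclotomic: `ℚ_1 = ℚ(√2)`, the twist `E^{(2)}` -/

section Rat

variable (W : WeierstrassCurve ℚ) [W.IsElliptic] (κ : ZpExtension ℚ 2) {γ : Field.absoluteGaloisGroup ℚ}

/-- ★★★ `K = ℚ`, `κ` cyclotomic with topological generator `γ`, `E` elliptic without a rational `2`-torsion abscissa:
**`#ker(N_{ℚ(√2)/ℚ} | Sel_{2^∞}(E/ℚ(√2))) ∣ #Sel_{2^∞}(E^{(2)}/ℚ) · #ker g_0(E^{(2)}/ℚ)`** — the signed object of the seed at the first cyclotomic layer is controlled by the honest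
`2^∞`-Selmer group of the twist `E^{(2)}` over `ℚ` and Greenberg's level-`0` control kernel of the twist (finite or not — a `Nat.card`). [cite: DokchitserDokchitserAnnals2010, Lemma 4.14 (proof)]
[cite: GreenbergLNM1716, §3 pp. 85–90] [cite: Washington1997, §13.1] -/
theorem natCard_normKer_dvd_quadraticTwist_two_selmer_mul_kerG (hκ : κ.IsCyclotomic) (hγ : κ.IsTopGenerator γ) (ht : ∀ x : ℚ, ¬ HasRationalTwoTorsionX W x) :
    Nat.card ↥(W.selmerLayer κ 1 ⊓ (W.conjH1 2 (κ.layerSubgroup 1) γ + AddMonoidHom.id (W.subgroupH1 2 (κ.layerSubgroup 1))).ker) ∣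
      Nat.card ((W.quadraticTwist 2).selmerLayer κ 0) * Nat.card ((W.quadraticTwist 2).KerG κ 0) := by
  obtain ⟨θ, hθ, hθ1, hγθ⟩ := AlignedTransportAtTwoHalfDescentLayerIndexGrowthFiniteTwistQuadratic.exists_sqrt_two_datum κ hκ hγ
  exact natCard_normKer_dvd_quadraticTwist_selmer_mul_kerG W κ (forall_two_nsmul_eq_zero W ht) hγ two_ne_zero hθ hθ1 hγθ

/-- ★★ `K = ℚ`, `κ` cyclotomic, `E` elliptic without a rational `2`-torsion abscissa: **`#Sel_{2^∞}(E/ℚ(√2)) ∣ (#Sel_{2^∞}(E/ℚ)·#ker g_0(E)) · (#Sel_{2^∞}(E^{(2)}/ℚ)·#ker g_0(E^{(2)}))`** —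
Kramer / Dokchitser–Dokchitser at the first cyclotomic layer in `2^∞`-currency with Greenberg-kernel defects. [cite: Kramer1981, Thm. 1, Prop. 7] [cite: DokchitserDokchitserAnnals2010, Lemma 4.14 (proof)]
[cite: GreenbergLNM1716, §3 pp. 85–90] -/
theorem natCard_selmerLayer_one_dvd_quadraticTwist_two_honest (hκ : κ.IsCyclotomic) (hγ : κ.IsTopGenerator γ) (ht : ∀ x : ℚ, ¬ HasRationalTwoTorsionX W x) :
    Nat.card (W.selmerLayer κ 1) ∣
      (Nat.card (W.selmerLayer κ 0) * Nat.card (W.KerG κ 0)) * (Nat.card ((W.quadraticTwist 2).selmerLayer κ 0) * Nat.card ((W.quadraticTwist 2).KerG κ 0)) := by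
  obtain ⟨θ, hθ, hθ1, hγθ⟩ := AlignedTransportAtTwoHalfDescentLayerIndexGrowthFiniteTwistQuadratic.exists_sqrt_two_datum κ hκ hγ
  exact natCard_selmerLayer_one_dvd_quadraticTwist_honest W κ (forall_two_nsmul_eq_zero W ht) hγ two_ne_zero hθ hθ1 hγθ

/-- ★★★ `K = ℚ`, `κ` cyclotomic, `E` elliptic without a rational `2`-torsion abscissa, ANY Pontryagin-dual datum with `X` f.g. torsion (any rank):
**`2^{μ₂(X(E/ℚ_∞))} ∣ #Sel_{2^∞}(E^{(2)}/ℚ) · #ker g_0(E^{(2)}/ℚ) · #ker g_1(E/ℚ(√2))`** — the seed's only non-print input `μ₂ = 0` is bounded FROM ABOVE by the honest `2^∞`-descent of the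
twist `E^{(2)}` over `ℚ` and two of Greenberg's control kernels. Honest caveat: a `Nat.card` divisibility — empty where a kernel is infinite (`#ker g_0(E^{(2)}/ℚ)` lives at the ADDITIVE
prime `2` of the twist; not decided here). Nothing numerical is asserted. [cite: GreenbergLNM1716, Conj. 1.11, §3 Lemmas 3.1–3.5, §4 Lemma 4.3] [cite: Washington1997, §13.1, §13.3 Thm. 13.13] -/
theorem pow_mu_dvd_quadraticTwist_two_selmer_mul_kerG_mul_kerG (hκ : κ.IsCyclotomic) (hγ : κ.IsTopGenerator γ) (ht : ∀ x : ℚ, ¬ HasRationalTwoTorsionX W x)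
    (D : W.SelmerDualData κ γ) [Module.Finite (IwasawaAlgebra 2) D.X] (hD : D.IsTorsion) :
    2 ^ D.mu ∣ Nat.card ((W.quadraticTwist 2).selmerLayer κ 0) * Nat.card ((W.quadraticTwist 2).KerG κ 0) * Nat.card (W.KerG κ 1) := by
  obtain ⟨θ, hθ, hθ1, hγθ⟩ := AlignedTransportAtTwoHalfDescentLayerIndexGrowthFiniteTwistQuadratic.exists_sqrt_two_datum κ hκ hγ
  exact pow_mu_dvd_quadraticTwist_selmer_mul_kerG_mul_kerG W κ (forall_two_nsmul_eq_zero W ht) hγ two_ne_zero hθ hθ1 hγθ D hD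

/-- ★★ `K = ℚ`, `κ` cyclotomic, `E` elliptic without a rational `2`-torsion abscissa, `X` f.g. torsion: THE HONEST DOOR AT THE FIRST CYCLOTOMIC LAYER —
**`Sel_{2^∞}(E^{(2)}/ℚ)`, `ker g_0(E^{(2)}/ℚ)` and `ker g_1(E/ℚ(√2))` all trivial (product `= 1`) ⟹ `μ₂(X(E/ℚ_∞)) = 0`**. [cite: GreenbergLNM1716, Conj. 1.11, §3 Lemmas 3.1–3.5, §4 Lemma 4.3]
[cite: Washington1997, §13.1, §13.3 Thm. 13.13] -/
theorem mu_eq_zero_of_quadraticTwist_two_selmer_mul_kerG_mul_kerG_lt (hκ : κ.IsCyclotomic) (hγ : κ.IsTopGenerator γ) (ht : ∀ x : ℚ, ¬ HasRationalTwoTorsionX W x)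
    (D : W.SelmerDualData κ γ) [Module.Finite (IwasawaAlgebra 2) D.X] (hD : D.IsTorsion)
    (hpos : 0 < Nat.card ((W.quadraticTwist 2).selmerLayer κ 0) * Nat.card ((W.quadraticTwist 2).KerG κ 0) * Nat.card (W.KerG κ 1))
    (hlt : Nat.card ((W.quadraticTwist 2).selmerLayer κ 0) * Nat.card ((W.quadraticTwist 2).KerG κ 0) * Nat.card (W.KerG κ 1) < 2) : D.mu = 0 := by
  obtain ⟨θ, hθ, hθ1, hγθ⟩ := AlignedTransportAtTwoHalfDescentLayerIndexGrowthFiniteTwistQuadratic.exists_sqrt_two_datum κ hκ hγ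
  exact mu_eq_zero_of_quadraticTwist_selmer_mul_kerG_mul_kerG_lt W κ (forall_two_nsmul_eq_zero W ht) hγ two_ne_zero hθ hθ1 hγθ D hD hpos hlt

end Rat

end Summit.BirchSwinnertonDyer.BirchSwinnertonDyer.Theorems.AlignedTransportAtTwoHalfDescentLayerIndexGrowthFiniteTwistHonest

end
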